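import Summits.CriticalPhenomena.PercolationContinuityZ3.Theorems.PercNearOneGluingAdditiveGluingTiedRaiseZeroPhi
import HarnessLib

/-!
# Crux `PercNearOneGluing.AdditiveGluing` (stmt-CriticalPhenomena-4576): TRL₃' from three φ-weighted pair inequalities with ARBITRARY
# weights, and from the M-conditioned kernel Φᴹ-TRL₃ (registered stub `stub_phiMTiedRaiseThree_pl`)

Support file (`--supports stmt-CriticalPhenomena-4576`, lead prim-png-lead-4576).  No definitions, no named facts, no sorries.

CORRECTION of the record (kit census j039609, 327 672 exact-tie instances): the pair inequality with the `N_l`-conditioned Kozma–Nitzan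
weights `μ(o↔a_l | a_l ↮ {other two})` (former stub `stub_phiTiedRaiseThree_pl`, now expired) FAILS on ≈ 0.02 % of instances (slack down to
−3.7·10⁻⁴, observer a.s.-almost glued to one relay); the version with the `M`-conditioned weights `μ(o↔a_l | a₁,a₂,a₃ pairwise separated)` holds
on all of them.  This file therefore (i) proves the tied-raise lemma TRL₃' (registered `stub_tiedRaiseThreeInf_pl`, for the given instance) from
the three pair inequalities with ANY real weights of positive sum (`tiedRaiseThreeInf_of_weights` — the weights are a certificate to be supplied),
and (ii) specialises to the M-conditioned kernel (`tiedRaiseThreeInf_of_phiM`, positive total mass).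
[cite: KozmaNitzan2024, Lemma 2 (p. 6), Lemma 4 (p. 9), Theorem 1 eq. (5)–(6) (p. 7)]
-/

namespace Summit.CriticalPhenomena.PercolationContinuityZ3.Theorems

open MeasureTheory Set Literature.Probability.LatticeModels Literature.Probability.Percolation

noncomputable section
open Classical

variable {n : ℕ}

/-- **TRL₃' from three weighted pair inequalities (any weights with positive sum).**  At a three-way tie with internal weights `< 1`:
if reals `Φ₁, Φ₂, Φ₃` with `Φ₁+Φ₂+Φ₃ > 0` satisfy, for each internal pair `e = {a_i,a_j}` with opposite relay `a_k`,
`Φ_k·(g_{a_i}(e) − g_{a_k}(e)) ≤ (Φ₁+Φ₂+Φ₃)·(g_{a_i}(e) − g_o(e))`, then for nonnegative pair weights with common relay rate `ρ` the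
observer's rate is `≤ ρ`. [cite: KozmaNitzan2024, Lemma 4 (p. 9)] -/
theorem tiedRaiseThreeInf_of_weights (w : Sym2 (Fin n) → unitInterval) (o b a₁ a₂ a₃ : Fin n) (x₁₂ x₁₃ x₂₃ ρ Φ₁ Φ₂ Φ₃ : ℝ)
    (h12 : a₁ ≠ a₂) (h13 : a₁ ≠ a₃) (h23 : a₂ ≠ a₃)
    (ht12 : (prodBernoulli w).real (openConn a₁ b) = (prodBernoulli w).real (openConn a₂ b))
    (ht13 : (prodBernoulli w).real (openConn a₁ b) = (prodBernoulli w).real (openConn a₃ b))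
    (hx12 : 0 ≤ x₁₂) (hx13 : 0 ≤ x₁₃) (hx23 : 0 ≤ x₂₃)
    (hr1 : x₁₂ * ((prodBernoulli (Function.update w s(a₁, a₂) 1)).real (openConn a₁ b) - (prodBernoulli (Function.update w s(a₁, a₂) 0)).real (openConn a₁ b)) + x₁₃ * ((prodBernoulli (Function.update w s(a₁, a₃) 1)).real (openConn a₁ b) - (prodBernoulli (Function.update w s(a₁, a₃) 0)).real (openConn a₁ b)) + x₂₃ * ((prodBernoulli (Function.update w s(a₂, a₃) 1)).real (openConn a₁ b) - (prodBernoulli (Function.update w s(a₂, a₃) 0)).real (openConn a₁ b)) = ρ) (hr2 : x₁₂ * ((prodBernoulli (Function.update w s(a₁, a₂) 1)).real (openConn a₂ b) - (prodBernoulli (Function.update w s(a₁, a₂) 0)).real (openConn a₂ b)) + x₁₃ * ((prodBernoulli (Function.update w s(a₁, a₃) 1)).real (openConn a₂ b) - (prodBernoulli (Function.update w s(a₁, a₃) 0)).real (openConn a₂ b)) + x₂₃ * ((prodBernoulli (Function.update w s(a₂, a₃) 1)).real (openConn a₂ b) - (prodBernoulli (Function.update w s(a₂, a₃) 0)).real (openConn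 a₂ b)) = ρ) (hr3 : x₁₂ * ((prodBernoulli (Function.update w s(a₁, a₂) 1)).real (openConn a₃ b) - (prodBernoulli (Function.update w s(a₁, a₂) 0)).real (openConn a₃ b)) + x₁₃ * ((prodBernoulli (Function.update w s(a₁, a₃) 1)).real (openConn a₃ b) - (prodBernoulli (Function.update w s(a₁, a₃) 0)).real (openConn a₃ b)) + x₂₃ * ((prodBernoulli (Function.update w s(a₂, a₃) 1)).real (openConn a₃ b) - (prodBernoulli (Function.update w s(a₂, a₃) 0)).real (openConn a₃ b)) = ρ)
    (hw12 : (w s(a₁, a₂) : ℝ) < 1) (hw13 : (w s(a₁, a₃) : ℝ) < 1) (hw23 : (w s(a₂, a₃) : ℝ) < 1)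
    (hS : 0 < Φ₁ + Φ₂ + Φ₃)
    (P12 : Φ₃ * (((prodBernoulli (Function.update w s(a₁, a₂) 1)).real (openConn a₁ b) - (prodBernoulli (Function.update w s(a₁, a₂) 0)).real (openConn a₁ b)) - ((prodBernoulli (Function.update w s(a₁, a₂) 1)).real (openConn a₃ b) - (prodBernoulli (Function.update w s(a₁, a₂) 0)).real (openConn a₃ b))) ≤ (Φ₁ + Φ₂ + Φ₃) * (((prodBernoulli (Function.update w s(a₁, a₂) 1)).real (openConn a₁ b) - (prodBernoulli (Function.update w s(a₁, a₂) 0)).real (openConn a₁ b)) - ((prodBernoulli (Function.update w s(a₁, a₂) 1)).real (openConn o b) - (prodBernoulli (Function.update w s(a₁, a₂) 0)).real (openConn o b))))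
    (P13 : Φ₂ * (((prodBernoulli (Function.update w s(a₁, a₃) 1)).real (openConn a₁ b) - (prodBernoulli (Function.update w s(a₁, a₃) 0)).real (openConn a₁ b)) - ((prodBernoulli (Function.update w s(a₁, a₃) 1)).real (openConn a₂ b) - (prodBernoulli (Function.update w s(a₁, a₃) 0)).real (openConn a₂ b))) ≤ (Φ₁ + Φ₂ + Φ₃) * (((prodBernoulli (Function.update w s(a₁, a₃) 1)).real (openConn a₁ b) - (prodBernoulli (Function.update w s(a₁, a₃) 0)).real (openConn a₁ b)) - ((prodBernoulli (Function.update w s(a₁, a₃) 1)).real (openConn o b) - (prodBernoulli (Function.update w s(a₁, a₃) 0)).real (openConn o b))))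
    (P23 : Φ₁ * (((prodBernoulli (Function.update w s(a₂, a₃) 1)).real (openConn a₂ b) - (prodBernoulli (Function.update w s(a₂, a₃) 0)).real (openConn a₂ b)) - ((prodBernoulli (Function.update w s(a₂, a₃) 1)).real (openConn a₁ b) - (prodBernoulli (Function.update w s(a₂, a₃) 0)).real (openConn a₁ b))) ≤ (Φ₁ + Φ₂ + Φ₃) * (((prodBernoulli (Function.update w s(a₂, a₃) 1)).real (openConn a₂ b) - (prodBernoulli (Function.update w s(a₂, a₃) 0)).real (openConn a₂ b)) - ((prodBernoulli (Function.update w s(a₂, a₃) 1)).real (openConn o b) - (prodBernoulli (Function.update w s(a₂, a₃) 0)).real (openConn o b)))) :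
    x₁₂ * ((prodBernoulli (Function.update w s(a₁, a₂) 1)).real (openConn o b) - (prodBernoulli (Function.update w s(a₁, a₂) 0)).real (openConn o b)) + x₁₃ * ((prodBernoulli (Function.update w s(a₁, a₃) 1)).real (openConn o b) - (prodBernoulli (Function.update w s(a₁, a₃) 0)).real (openConn o b)) + x₂₃ * ((prodBernoulli (Function.update w s(a₂, a₃) 1)).real (openConn o b) - (prodBernoulli (Function.update w s(a₂, a₃) 0)).real (openConn o b)) ≤ ρ := by
  have ht23 : (prodBernoulli w).real (openConn a₂ b) = (prodBernoulli w).real (openConn a₃ b) := by rw [← ht12, ht13]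
  have c12 := tiedRaise_rate_eq_of_tie w h12 b ht12 hw12
  have c13 := tiedRaise_rate_eq_of_tie w h13 b ht13 hw13
  have c23 := tiedRaise_rate_eq_of_tie w h23 b ht23 hw23
  exact tiedRaise_core_alg _ _ _ _ _ _ _ _ _ _ _ _ _ _ _ _ _ _ _ _ _ hS rfl rfl hx12 hx13 hx23 P12 P13 P23 c12 c13 c23 hr1 hr2 hr3

/-- The all-separated event `M` is symmetric in the relays (two relabelings used below). [folklore] -/
theorem tiedRaise_M_perm (a₁ a₂ a₃ : Fin n) :
    ((openConn a₁ a₃)ᶜ ∩ (openConn a₁ a₂)ᶜ ∩ (openConn a₃ a₂)ᶜ : Set (BondConfig (Fin n))) =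
        ((openConn a₁ a₂)ᶜ ∩ (openConn a₁ a₃)ᶜ ∩ (openConn a₂ a₃)ᶜ : Set (BondConfig (Fin n))) ∧
      ((openConn a₂ a₃)ᶜ ∩ (openConn a₂ a₁)ᶜ ∩ (openConn a₃ a₁)ᶜ : Set (BondConfig (Fin n))) =
        ((openConn a₁ a₂)ᶜ ∩ (openConn a₁ a₃)ᶜ ∩ (openConn a₂ a₃)ᶜ : Set (BondConfig (Fin n))) := by
  constructor
  · ext ω
    simp only [Set.mem_inter_iff, Set.mem_compl_iff]
    constructor
    · rintro ⟨⟨h13, h12⟩, h32⟩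
      exact ⟨⟨h12, h13⟩, fun h => h32 (SimpleGraph.Reachable.symm h)⟩
    · rintro ⟨⟨h12, h13⟩, h23⟩
      exact ⟨⟨h13, h12⟩, fun h => h23 (SimpleGraph.Reachable.symm h)⟩
  · ext ω
    simp only [Set.mem_inter_iff, Set.mem_compl_iff]
    constructor
    · rintro ⟨⟨h23, h21⟩, h31⟩
      exact ⟨⟨fun h => h21 (SimpleGraph.Reachable.symm h), fun h => h31 (SimpleGraph.Reachable.symm h)⟩, h23⟩
    · rintro ⟨⟨h12, h13⟩, h23⟩
      exact ⟨⟨h23, fun h => h12 (SimpleGraph.Reachable.symm h)⟩, fun h => h13 (SimpleGraph.Reachable.symm h)⟩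

/-- **TRL₃' from the M-conditioned kernel Φᴹ-TRL₃** (registered stub `stub_phiMTiedRaiseThree_pl`, weights `μ(o↔a_l ∩ M)`,
`M` = the three relays pairwise separated), when the observer's total M-mass is positive. [cite: KozmaNitzan2024, Lemma 2 (p. 6), Lemma 4 (p. 9)] -/
theorem tiedRaiseThreeInf_of_phiM
    (hΦ : ∀ (n : ℕ) (w : Sym2 (Fin n) → unitInterval) (o b a₁ a₂ a₃ : Fin n), a₁ ≠ a₂ → a₁ ≠ a₃ → a₂ ≠ a₃ → (prodBernoulli w).real (openConn a₁ b) = (prodBernoulli w).real (openConn a₂ b) → (prodBernoulli w).real (openConn a₁ b) = (prodBernoulli w).real (openConn a₃ b) → (prodBernoulli w).real (openConn o a₃ ∩ ((openConn a₁ a₂)ᶜ ∩ (openConn a₁ a₃)ᶜ ∩ (openConn a₂ a₃)ᶜ : Set (BondConfig (Fin n)))) * (((prodBernoulli (Function.update w s(a₁, a₂) 1)).real (openConn a₁ b) - (prodBernoulli (Function.update w s(a₁, a₂) 0)).real (openConn a₁ b)) - ((prodBernoulli (Function.update w s(a₁, a₂) 1)).real (openConn a₃ b) - (prodBernoulli (Function.update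 w s(a₁, a₂) 0)).real (openConn a₃ b))) ≤ ((prodBernoulli w).real (openConn o a₁ ∩ ((openConn a₁ a₂)ᶜ ∩ (openConn a₁ a₃)ᶜ ∩ (openConn a₂ a₃)ᶜ : Set (BondConfig (Fin n)))) + (prodBernoulli w).real (openConn o a₂ ∩ ((openConn a₁ a₂)ᶜ ∩ (openConn a₁ a₃)ᶜ ∩ (openConn a₂ a₃)ᶜ : Set (BondConfig (Fin n)))) + (prodBernoulli w).real (openConn o a₃ ∩ ((openConn a₁ a₂)ᶜ ∩ (openConn a₁ a₃)ᶜ ∩ (openConn a₂ a₃)ᶜ : Set (BondConfig (Fin n))))) * (((prodBernoulli (Function.update w s(a₁, a₂) 1)).real (openConn a₁ b) - (prodBernoulli (Function.update w s(a₁, a₂) 0)).real (openConn a₁ b)) - ((prodBernoulli (Function.update w s(a₁, a₂) 1)).real (openConn o b) - (prodBernoulli (Function.update w s(a₁, a₂) 0)).real (openConn o b))))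
    (n : ℕ) (w : Sym2 (Fin n) → unitInterval) (o b a₁ a₂ a₃ : Fin n) (x₁₂ x₁₃ x₂₃ ρ : ℝ)
    (h12 : a₁ ≠ a₂) (h13 : a₁ ≠ a₃) (h23 : a₂ ≠ a₃)
    (ht12 : (prodBernoulli w).real (openConn a₁ b) = (prodBernoulli w).real (openConn a₂ b))
    (ht13 : (prodBernoulli w).real (openConn a₁ b) = (prodBernoulli w).real (openConn a₃ b))
    (hx12 : 0 ≤ x₁₂) (hx13 : 0 ≤ x₁₃) (hx23 : 0 ≤ x₂₃)
    (hr1 : x₁₂ * ((prodBernoulli (Function.update w s(a₁, a₂) 1)).real (openConn a₁ b) - (prodBernoulli (Function.update w s(a₁, a₂) 0)).real (openConn a₁ b)) + x₁₃ * ((prodBernoulli (Function.update w s(a₁, a₃) 1)).real (openConn a₁ b) - (prodBernoulli (Function.update w s(a₁, a₃) 0)).real (openConn a₁ b)) + x₂₃ * ((prodBernoulli (Function.update w s(a₂, a₃) 1)).real (openConn a₁ b) - (prodBernoulli (Function.update w s(a₂, a₃) 0)).real (openConn a₁ b)) = ρ) (hr2 : x₁₂ * ((prodBernoulli (Function.update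 w s(a₁, a₂) 1)).real (openConn a₂ b) - (prodBernoulli (Function.update w s(a₁, a₂) 0)).real (openConn a₂ b)) + x₁₃ * ((prodBernoulli (Function.update w s(a₁, a₃) 1)).real (openConn a₂ b) - (prodBernoulli (Function.update w s(a₁, a₃) 0)).real (openConn a₂ b)) + x₂₃ * ((prodBernoulli (Function.update w s(a₂, a₃) 1)).real (openConn a₂ b) - (prodBernoulli (Function.update w s(a₂, a₃) 0)).real (openConn a₂ b)) = ρ) (hr3 : x₁₂ * ((prodBernoulli (Function.update w s(a₁, a₂) 1)).real (openConn a₃ b) - (prodBernoulli (Function.update w s(a₁, a₂) 0)).real (openConn a₃ b)) + x₁₃ * ((prodBernoulli (Function.update w s(a₁, a₃) 1)).real (openConn a₃ b) - (prodBernoulli (Function.update w s(a₁, a₃) 0)).real (openConn a₃ b)) + x₂₃ * ((prodBernoulli (Function.update w s(a₂, a₃) 1)).real (openConn a₃ b) - (prodBernoulli (Function.update w s(a₂, a₃) 0)).real (openConn a₃ b)) = ρ)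
    (hw12 : (w s(a₁, a₂) : ℝ) < 1) (hw13 : (w s(a₁, a₃) : ℝ) < 1) (hw23 : (w s(a₂, a₃) : ℝ) < 1)
    (hS : 0 < (prodBernoulli w).real (openConn o a₁ ∩ ((openConn a₁ a₂)ᶜ ∩ (openConn a₁ a₃)ᶜ ∩ (openConn a₂ a₃)ᶜ : Set (BondConfig (Fin n)))) + (prodBernoulli w).real (openConn o a₂ ∩ ((openConn a₁ a₂)ᶜ ∩ (openConn a₁ a₃)ᶜ ∩ (openConn a₂ a₃)ᶜ : Set (BondConfig (Fin n)))) + (prodBernoulli w).real (openConn o a₃ ∩ ((openConn a₁ a₂)ᶜ ∩ (openConn a₁ a₃)ᶜ ∩ (openConn a₂ a₃)ᶜ : Set (BondConfig (Fin n))))) :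
    x₁₂ * ((prodBernoulli (Function.update w s(a₁, a₂) 1)).real (openConn o b) - (prodBernoulli (Function.update w s(a₁, a₂) 0)).real (openConn o b)) + x₁₃ * ((prodBernoulli (Function.update w s(a₁, a₃) 1)).real (openConn o b) - (prodBernoulli (Function.update w s(a₁, a₃) 0)).real (openConn o b)) + x₂₃ * ((prodBernoulli (Function.update w s(a₂, a₃) 1)).real (openConn o b) - (prodBernoulli (Function.update w s(a₂, a₃) 0)).real (openConn o b)) ≤ ρ := by
  have ht23 : (prodBernoulli w).real (openConn a₂ b) = (prodBernoulli w).real (openConn a₃ b) := by rw [← ht12, ht13]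
  obtain ⟨hMa, hMb⟩ := tiedRaise_M_perm a₁ a₂ a₃ (n := n)
  have P12 := hΦ n w o b a₁ a₂ a₃ h12 h13 h23 ht12 ht13
  have P13 := hΦ n w o b a₁ a₃ a₂ h13 h12 h23.symm ht13 ht12
  have P23 := hΦ n w o b a₂ a₃ a₁ h23 h12.symm h13.symm ht23 ht12.symm
  rw [hMa] at P13
  rw [hMb] at P23
  have P13' : (prodBernoulli w).real (openConn o a₂ ∩ ((openConn a₁ a₂)ᶜ ∩ (openConn a₁ a₃)ᶜ ∩ (openConn a₂ a₃)ᶜ : Set (BondConfig (Fin n)))) * (((prodBernoulli (Function.update w s(a₁, a₃) 1)).real (openConn a₁ b) - (prodBernoulli (Function.update w s(a₁, a₃) 0)).real (openConn a₁ b)) - ((prodBernoulli (Function.update w s(a₁, a₃) 1)).real (openConn a₂ b) - (prodBernoulli (Function.update w s(a₁, a₃) 0)).real (openConn a₂ b))) ≤ ((prodBernoulli w).real (openConn o a₁ ∩ ((openConn a₁ a₂)ᶜ ∩ (openConn a₁ a₃)ᶜ ∩ (openConn a₂ a₃)ᶜ : Set (BondConfig (Fin n)))) + (prodBernoulli w).real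 (openConn o a₂ ∩ ((openConn a₁ a₂)ᶜ ∩ (openConn a₁ a₃)ᶜ ∩ (openConn a₂ a₃)ᶜ : Set (BondConfig (Fin n)))) + (prodBernoulli w).real (openConn o a₃ ∩ ((openConn a₁ a₂)ᶜ ∩ (openConn a₁ a₃)ᶜ ∩ (openConn a₂ a₃)ᶜ : Set (BondConfig (Fin n))))) * (((prodBernoulli (Function.update w s(a₁, a₃) 1)).real (openConn a₁ b) - (prodBernoulli (Function.update w s(a₁, a₃) 0)).real (openConn a₁ b)) - ((prodBernoulli (Function.update w s(a₁, a₃) 1)).real (openConn o b) - (prodBernoulli (Function.update w s(a₁, a₃) 0)).real (openConn o b))) := by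
    have hs : (prodBernoulli w).real (openConn o a₁ ∩ ((openConn a₁ a₂)ᶜ ∩ (openConn a₁ a₃)ᶜ ∩ (openConn a₂ a₃)ᶜ : Set (BondConfig (Fin n)))) + (prodBernoulli w).real (openConn o a₃ ∩ ((openConn a₁ a₂)ᶜ ∩ (openConn a₁ a₃)ᶜ ∩ (openConn a₂ a₃)ᶜ : Set (BondConfig (Fin n)))) + (prodBernoulli w).real (openConn o a₂ ∩ ((openConn a₁ a₂)ᶜ ∩ (openConn a₁ a₃)ᶜ ∩ (openConn a₂ a₃)ᶜ : Set (BondConfig (Fin n)))) = (prodBernoulli w).real (openConn o a₁ ∩ ((openConn a₁ a₂)ᶜ ∩ (openConn a₁ a₃)ᶜ ∩ (openConn a₂ a₃)ᶜ : Set (BondConfig (Fin n)))) + (prodBernoulli w).real (openConn o a₂ ∩ ((openConn a₁ a₂)ᶜ ∩ (openConn a₁ a₃)ᶜ ∩ (openConn a₂ a₃)ᶜ : Set (BondConfig (Fin n)))) + (prodBernoulli w).real (openConn o a₃ ∩ ((openConn a₁ a₂)ᶜ ∩ (openConn a₁ a₃)ᶜ ∩ (openConn a₂ a₃)ᶜ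 : Set (BondConfig (Fin n)))) := by ring
    rw [hs] at P13; exact P13
  have P23' : (prodBernoulli w).real (openConn o a₁ ∩ ((openConn a₁ a₂)ᶜ ∩ (openConn a₁ a₃)ᶜ ∩ (openConn a₂ a₃)ᶜ : Set (BondConfig (Fin n)))) * (((prodBernoulli (Function.update w s(a₂, a₃) 1)).real (openConn a₂ b) - (prodBernoulli (Function.update w s(a₂, a₃) 0)).real (openConn a₂ b)) - ((prodBernoulli (Function.update w s(a₂, a₃) 1)).real (openConn a₁ b) - (prodBernoulli (Function.update w s(a₂, a₃) 0)).real (openConn a₁ b))) ≤ ((prodBernoulli w).real (openConn o a₁ ∩ ((openConn a₁ a₂)ᶜ ∩ (openConn a₁ a₃)ᶜ ∩ (openConn a₂ a₃)ᶜ : Set (BondConfig (Fin n)))) + (prodBernoulli w).real (openConn o a₂ ∩ ((openConn a₁ a₂)ᶜ ∩ (openConn a₁ a₃)ᶜ ∩ (openConn a₂ a₃)ᶜ : Set (BondConfig (Fin n)))) + (prodBernoulli w).real (openConn o a₃ ∩ ((openConn a₁ a₂)ᶜ ∩ (openConn a₁ a₃)ᶜ ∩ (openConn a₂ a₃)ᶜ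 : Set (BondConfig (Fin n))))) * (((prodBernoulli (Function.update w s(a₂, a₃) 1)).real (openConn a₂ b) - (prodBernoulli (Function.update w s(a₂, a₃) 0)).real (openConn a₂ b)) - ((prodBernoulli (Function.update w s(a₂, a₃) 1)).real (openConn o b) - (prodBernoulli (Function.update w s(a₂, a₃) 0)).real (openConn o b))) := by
    have hs : (prodBernoulli w).real (openConn o a₂ ∩ ((openConn a₁ a₂)ᶜ ∩ (openConn a₁ a₃)ᶜ ∩ (openConn a₂ a₃)ᶜ : Set (BondConfig (Fin n)))) + (prodBernoulli w).real (openConn o a₃ ∩ ((openConn a₁ a₂)ᶜ ∩ (openConn a₁ a₃)ᶜ ∩ (openConn a₂ a₃)ᶜ : Set (BondConfig (Fin n)))) + (prodBernoulli w).real (openConn o a₁ ∩ ((openConn a₁ a₂)ᶜ ∩ (openConn a₁ a₃)ᶜ ∩ (openConn a₂ a₃)ᶜ : Set (BondConfig (Fin n)))) = (prodBernoulli w).real (openConn o a₁ ∩ ((openConn a₁ a₂)ᶜ ∩ (openConn a₁ a₃)ᶜ ∩ (openConn a₂ a₃)ᶜ : Set (BondConfig (Fin n)))) + (prodBernoulli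 w).real (openConn o a₂ ∩ ((openConn a₁ a₂)ᶜ ∩ (openConn a₁ a₃)ᶜ ∩ (openConn a₂ a₃)ᶜ : Set (BondConfig (Fin n)))) + (prodBernoulli w).real (openConn o a₃ ∩ ((openConn a₁ a₂)ᶜ ∩ (openConn a₁ a₃)ᶜ ∩ (openConn a₂ a₃)ᶜ : Set (BondConfig (Fin n)))) := by ring
    rw [hs] at P23; exact P23
  exact tiedRaiseThreeInf_of_weights w o b a₁ a₂ a₃ x₁₂ x₁₃ x₂₃ ρ _ _ _ h12 h13 h23 ht12 ht13 hx12 hx13 hx23 hr1 hr2 hr3 hw12 hw13 hw23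
    hS P12 P13' P23'

end

end Summit.CriticalPhenomena.PercolationContinuityZ3.Theorems
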